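import Literature.MathematicalPhysics.QuantumFieldTheory.Balaban1983to89.B9Eq373KatoPairedRemainderPureGauge

/-!
# `Balaban1983to89.B9Eq342GradientRowCubeLetters` — T. Bałaban, *Propagators for lattice gauge theories in a background field*, Commun. Math. Phys. **99**
# (1985) 389–434 [Balaban1985BackgroundPropagators] (3.35) p. 396 (the regularity class: on every cube `□` of the class a gauge `u` with `U^u = e^{iηA}`,
# `|A| ≤ O(1)Mα₀(L^jη)⁻¹`, `|∇^ηA| ≤ O(1)Mα₀(L^jη)⁻²`), (3.28)–(3.31) p. 395 (gauge covariance), (3.43)–(3.46) p. 398 (localisation to cubes), (3.70)–(3.73)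
# pp. 404–405: **STOREY J's (3.35) LETTERS, LOCALISED TO A CUBE — if the background `U` AGREES with a gauged small field on a bond set `p` (`U(b) = (V^g)(b)`
# for `b ∈ p`; `g` fibrewise isometric, `V(b) ∈ U1`, `‖V(b) − 1‖ ≤ δ₀` on `p`), then at the bonds of `p` the transporters of `U` against those of the pure-gauge
# skeleton `U⁰ = 1^g` obey the four fibre letters of `B9Eq342GradientRowAssembly` §3 (`hδ`, `hBp`∕`hBm`, `hBt` with `δ = b = 2M_φM_φ′δ₀`; `hD` with
# `b′ = 2M_φM_φ′·‖V(x,μ) − V(x−e_μ,μ)‖`, or `b′ = 2M_φM_φ′·η(ηa′)e^{ηr}` in the gauge `V = e^{iηA}` with the (3.35) gradient letter `a′`)** — the transporter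
# of a bond depends on that bond's variable only, so `B9Eq331PureGaugeResolventConjugation` §5∕§6 (stated for `U = V^g` on the whole torus) localise verbatim;
# the pair `(g, V) = (g₀⁻¹, Ũ)` per cube is `B9Eq387CubeReductionGaugeBackground.exists_gauge_background_letters` + `B9Eq328GaugeAction.gaugeU_inv_gaugeU`
# (successor memo `t4/b2b-balaban-t4-ne9-formalise-leaf-05/g84/V28-NEXT.md` item 4, `STOREY-J-ASSEMBLY-g84.md` §3)

statement-level skeleton of published theorems with citation tags; proofs where landed; nothing here is a claim about the Yang–Mills mass gap

CITATION HEADER (lean-in-tree rule).  Audit cell `pub-balaban`, sub-cell `t4`, BINDER row NE9; filed by NE9 crux-team LEAF PROVER 05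
(`b2b-balaban-t4-ne9-formalise-leaf-05`, gen 85).  Imports this lineage's `B9Eq373KatoPairedRemainderPureGauge` (g83; through it
`B9Eq331PureGaugeResolventConjugation` (K30) §5∕§6, `B9Eq373TransporterLipschitzLetters` (K31), `B9Eq384RemainderLetters` §4).  SOURCE READ first-hand in the
held text layer [Balaban1985BackgroundPropagators] (`paper:balaban1985-cmp99-background-propagators`): p. 396 (3.35) *«for a configuration U there exists a
gauge transformation u on □ such that U^u = e^{iηA}, and … |A| < O(1)Mα₀(L^jη)⁻¹, |∇^ηA| < O(1)Mα₀(L^jη)⁻² on □»*; p. 395 (3.28)–(3.31); p. 398 (3.43)–(3.46);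
pp. 404–405 (3.70)–(3.73).  The localisation is [folklore] (`adTransportW φ U b = Ad(U(b))`, `B9Eq328GaugeAction.adTransportW_eq_AdW`, `rfl`); the sizes are
the tree's letters BY NAME; nothing printed is a hypothesis except the (3.35) data themselves (`δ₀`, `r`, `a′` — the consumer's); the `[cite: …]` tags are TEXT
LOCATIONS.

WHAT IS PROVED (sorry-free; 0 `def`; [folklore]).  Context: `φ : W ≃ₗ[ℂ] 𝔸`, `‖φw‖ ≤ M_φ‖w‖`, `‖φ⁻¹X‖ ≤ M_φ′‖X‖`, `0 ≤ M_φ, M_φ′`; `g : TSite d P → 𝔸ˣ` with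
`hAd`; `V : Bond d P → 𝔸ˣ` with `V(b) ∈ U1`; the background `U`; a bond predicate `p` with `hagree : p b → U b = gaugeU g V b`; `hδ₀ : p b → ‖V(b) − 1‖ ≤ δ₀`.
Notation of the statements: `R_U = adTransportW φ U`, `S_U = adTransportW φ U⁻¹`, `R⁰ = adTransportW φ (gaugeU g 1)`, `S⁰` its inverse field.
* §1 **`adTransportW_congr`**, **`adTransportW_inv_congr`** — `U b = U′ b ⟹ R_U(b) = R_{U′}(b)`, `S_U(b) = S_{U′}(b)`.
* §2 on `p`: **`norm_sub_pureGauge_le_on`** (`‖R_U(b)w − R⁰(b)w‖ ≤ 2M_φM_φ′δ₀‖w‖` — `hδ`), **`norm_rel_sub_le_on`** (`‖R⁰(b)(S_U(b)w) − w‖ ≤ 2M_φM_φ′δ₀‖w‖` —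
  `hBp`∕`hBm`), **`norm_inv_sub_le_on`** (`‖S⁰(b)w − S_U(b)w‖ ≤ 2M_φM_φ′δ₀‖w‖` — `hBt`), **`norm_covDiff_le_on`** (the `hD` expression at `x, μ` with
  `(x,μ), (x−e_μ,μ) ∈ p` is `≤ ε′‖w‖` given `‖S_V(x,μ)w − S_V(x−e_μ,μ)w‖ ≤ ε′‖w‖`), **`norm_covDiff_le_on_of_sub`** (`ε′ = 2M_φM_φ′·‖V(x,μ) − V(x−e_μ,μ)‖`),
  **`norm_covDiff_le_on_exp`** (`V = e^{iηA}` as group elements, `η ≥ 0`, `‖A‖ ≤ r` at the two bonds, `‖A(x,μ) − A(x−e_μ,μ)‖ ≤ ηa′`: `ε′ = 2M_φM_φ′·(η(ηa′)e^{ηr})`).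
* §4 **`agree_inv_of_gauge_eq`** (`gaugeU g₀ U = Ũ` on `p` ⟹ `hagree` with `g := g₀⁻¹`, `V := Ũ`), **`hAd_inv`** (`hAd` for `g₀⁻¹` from `hAd` for `g₀`) —
  the per-cube pair of `B9Eq387CubeReductionGaugeBackground.exists_gauge_background_letters` inhabits this file's hypotheses.
* §3 **`cube_letters`** — packaging for `B9Eq342GradientRowAssembly` §3∕§4∕§5 at ONE output bond: for a site set `Ω` with `(x,μ), (x−e_μ,μ) ∈ p` for all
  `x ∈ Ω`, `μ`, and a consecutive-transporter letter `ε′` on `Ω`: the conjunction `hBp ∧ hBm ∧ hBt ∧ hD` in the assembly's literal shapes (`b = 2M_φM_φ′δ₀`,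
  `b′ = ε′`); `hδ` at `b₀ ∈ p` is §2's first lemma.
HONEST SCOPE.  Localisation and naming only; `δ₀ = O(η|A|)`, `a′ = O(|∇^ηA|)` are the (3.35) HYPOTHESES of Thm 3.1 (the per-cube reduction of the tree
supplies `δ₀ = l1(n)·δ` from small plaquettes, NOT `a′`); which cube serves which output bond `b₀`, the margin between `Ω_{b₀}` and the cube, and the
t-freeness bookkeeping `|t|·b = O(|A|∕η·η)`, `t²·b′ = O(a′)` are the consumer's.  Nothing of [B9] Thm 3.1∕3.3∕3.11 is asserted, valued or discharged.  NOT NE9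
(cell pub-balaban: NE9 NOT PRINTED ∕ NOT PROVED; «NE9 ⇐ the named binders»; row WALLED ON A MODEL (O-NE9-1; #5 UNRULED); spine PROVED 0∕9; rung (B)+1 on a
finite T⁴ — NOT infinite volume, NOT mass gap, NOT Clay; HONEST DEPENDENCY: continuum YM on T⁴ ⇐ BetaPertH ∧ nine spine estimates (0/9 proved); BetaPertH ⇐
(D1) ∧ (D4) ∧ CAP+tail; G-an2-4 gates asym, D1 and NE2/3/4).  NEW file; nothing modified.  Net new unproved facts: 0.
-/

noncomputable section

set_option autoImplicit false

open scoped InnerProductSpace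

namespace Literature.MathematicalPhysics.QuantumFieldTheory.Balaban1983to89.B9Eq342GradientRowCubeLetters

open B4Sect5Torus (TSite)
open B9SectCLatticeCarrier (Bond unshift)
open B9Eq310HessianOperator (adTransportW)
open B9Eq328GaugeAction (gaugeU AdW adTransportW_eq_AdW gaugeU_apply AdW_inv_apply)
open B7Prop1Explicit (U1)
open B9Eq331PureGaugeResolventConjugation (norm_adTransportW_gaugeU_sub_pureGauge_le norm_relTransporter_pureGauge_sub_le
  norm_adTransportW_pureGauge_inv_sub_gaugeU_inv_le norm_covDiff_relTransporter_pureGauge_le)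
open B9Eq373KatoPairedRemainderPureGauge (norm_adTransportW_inv_sub_self_le)
open B9Eq373TransporterLipschitzLetters (norm_adTransportW_inv_sub_adTransportW_inv_le norm_exp_smul_sub_exp_smul_le)
open B9Eq384RemainderLetters (norm_adTransportW_sub_le)

variable {d : ℕ} {Pd : Fin d → ℕ} {𝔸 : Type*} [NormedRing 𝔸] [NormedAlgebra ℂ 𝔸] [NormOneClass 𝔸]
  {W : Type*} [NormedAddCommGroup W] [InnerProductSpace ℂ W] (φ : W ≃ₗ[ℂ] 𝔸) {Mφ Mφ' : ℝ}
  (hφ : ∀ w, ‖φ w‖ ≤ Mφ * ‖w‖) (hφ' : ∀ X, ‖φ.symm X‖ ≤ Mφ' * ‖X‖) (hMφ : 0 ≤ Mφ) (hMφ' : 0 ≤ Mφ')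
  (g : TSite d Pd → 𝔸ˣ) (hAd : ∀ (x : TSite d Pd) (v v' : W), ⟪AdW φ (g x) v, AdW φ (g x) v'⟫_ℂ = ⟪v, v'⟫_ℂ)
  (V : Bond d Pd → 𝔸ˣ) (hV1 : ∀ b, V b ∈ U1 𝔸) (U : Bond d Pd → 𝔸ˣ) (p : Bond d Pd → Prop) (hagree : ∀ b, p b → U b = gaugeU g V b)
  {δ₀ : ℝ} (hδ₀ : ∀ b, p b → ‖(V b : 𝔸) - 1‖ ≤ δ₀)

/-! ## §1 The transporter of a bond depends on that bond's variable only -/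

omit [NormOneClass 𝔸] in
/-- `U(b) = U′(b) ⟹ R(U(b)) = R(U′(b))` as maps of the fibre. [folklore] [cite: Balaban1985BackgroundPropagators, (3.3) p.391] -/
theorem adTransportW_congr {U U' : Bond d Pd → 𝔸ˣ} {b : Bond d Pd} (h : U b = U' b) : adTransportW φ U b = adTransportW φ U' b := by
  rw [adTransportW_eq_AdW, adTransportW_eq_AdW, h]

omit [NormOneClass 𝔸] in
/-- `U(b) = U′(b) ⟹ R(U(b)⁻¹) = R(U′(b)⁻¹)`. [folklore] [cite: Balaban1985BackgroundPropagators, (3.8) p.392] -/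
theorem adTransportW_inv_congr {U U' : Bond d Pd → 𝔸ˣ} {b : Bond d Pd} (h : U b = U' b) :
    adTransportW φ (fun b => (U b)⁻¹) b = adTransportW φ (fun b => (U' b)⁻¹) b := by
  rw [adTransportW_eq_AdW, adTransportW_eq_AdW, h]

/-! ## §2 The four fibre letters on the bond set `p` -/

include hφ hφ' hMφ' hAd hV1 hagree hδ₀ in
/-- **`hδ` ON THE CUBE**: `b ∈ p ⟹ ‖R(U(b))w − R(U⁰(b))w‖ ≤ 2M_φM_φ′δ₀·‖w‖`, `U⁰ = 1^g`. [folklore]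
[cite: Balaban1985BackgroundPropagators, (3.35) p.396, (3.70) p.404, (3.28)–(3.30) p.395] -/
theorem norm_sub_pureGauge_le_on (b : Bond d Pd) (hb : p b) (w : W) :
    ‖adTransportW φ U b w - adTransportW φ (gaugeU g 1) b w‖ ≤ 2 * Mφ * Mφ' * δ₀ * ‖w‖ := by
  rw [adTransportW_congr φ (hagree b hb)]
  exact norm_adTransportW_gaugeU_sub_pureGauge_le φ g V hAd b (fun w => norm_adTransportW_sub_le φ hφ hφ' hMφ' V b (hV1 b) (hδ₀ b hb) w) w

include hφ hφ' hMφ' hAd hV1 hagree hδ₀ in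
/-- **`hBp`∕`hBm` ON THE CUBE**: `b ∈ p ⟹ ‖R(U⁰(b))·R(U(b)⁻¹)w − w‖ ≤ 2M_φM_φ′δ₀·‖w‖` (the relative transporter minus one). [folklore]
[cite: Balaban1985BackgroundPropagators, (3.35) p.396, (3.70) p.404, (3.73) p.405] -/
theorem norm_rel_sub_le_on (b : Bond d Pd) (hb : p b) (w : W) :
    ‖adTransportW φ (gaugeU g 1) b (adTransportW φ (fun b => (U b)⁻¹) b w) - w‖ ≤ 2 * Mφ * Mφ' * δ₀ * ‖w‖ := by
  rw [adTransportW_inv_congr φ (hagree b hb)]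
  exact norm_relTransporter_pureGauge_sub_le φ g V hAd b (fun w => norm_adTransportW_inv_sub_self_le φ hφ hφ' hMφ' V hV1 b (hδ₀ b hb) w) w

include hφ hφ' hMφ' hAd hV1 hagree hδ₀ in
/-- **`hBt` ON THE CUBE**: `b ∈ p ⟹ ‖R(U⁰(b)⁻¹)w − R(U(b)⁻¹)w‖ ≤ 2M_φM_φ′δ₀·‖w‖`. [folklore]
[cite: Balaban1985BackgroundPropagators, (3.35) p.396, (3.70) p.404, (3.8) p.392] -/
theorem norm_inv_sub_le_on (b : Bond d Pd) (hb : p b) (w : W) :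
    ‖adTransportW φ (fun b => (gaugeU g 1 b)⁻¹) b w - adTransportW φ (fun b => (U b)⁻¹) b w‖ ≤ 2 * Mφ * Mφ' * δ₀ * ‖w‖ := by
  rw [adTransportW_inv_congr φ (hagree b hb)]
  exact norm_adTransportW_pureGauge_inv_sub_gaugeU_inv_le φ g V hAd b
    (fun w => norm_adTransportW_inv_sub_self_le φ hφ hφ' hMφ' V hV1 b (hδ₀ b hb) w) w

omit [NormOneClass 𝔸] in
include hAd hagree in
/-- **`hD` ON THE CUBE**: at a site `x` and direction `μ` with `(x,μ), (x−e_μ,μ) ∈ p` and a consecutive-transporter letter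
`‖R(V(x,μ)⁻¹)w − R(V(x−e_μ,μ)⁻¹)w‖ ≤ ε′‖w‖`, the `U⁰`-covariant difference of the relative transporter `B = R(U⁰)R(U⁻¹) − 1` along `μ` is `≤ ε′‖w‖`
(`B9Eq331PureGaugeResolventConjugation.norm_covDiff_relTransporter_pureGauge_le`, localised). [folklore]
[cite: Balaban1985BackgroundPropagators, (3.73) p.405, (3.35) p.396, (3.28) p.395] -/
theorem norm_covDiff_le_on (x : TSite d Pd) (μ : Fin d) (hx : p (x, μ)) (hx' : p (unshift μ x, μ)) {ε' : ℝ}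
    (hdV' : ∀ w, ‖adTransportW φ (fun b => (V b)⁻¹) (x, μ) w - adTransportW φ (fun b => (V b)⁻¹) (unshift μ x, μ) w‖ ≤ ε' * ‖w‖) (w : W) :
    ‖(adTransportW φ (gaugeU g 1) (x, μ) (adTransportW φ (fun b => (U b)⁻¹) (x, μ) w) - w) -
      adTransportW φ (fun b => (gaugeU g 1 b)⁻¹) (unshift μ x, μ)
        (adTransportW φ (gaugeU g 1) (unshift μ x, μ) (adTransportW φ (fun b => (U b)⁻¹) (unshift μ x, μ)
          (adTransportW φ (gaugeU g 1) (unshift μ x, μ) w)) - adTransportW φ (gaugeU g 1) (unshift μ x, μ) w)‖ ≤ ε' * ‖w‖ := by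
  rw [adTransportW_inv_congr φ (hagree _ hx), adTransportW_inv_congr φ (hagree _ hx')]
  exact norm_covDiff_relTransporter_pureGauge_le φ g V hAd x μ hdV' w

include hφ hφ' hMφ' hAd hV1 hagree in
/-- **`hD` ON THE CUBE FROM THE BOND-VARIABLE DIFFERENCE**: `ε′ = 2M_φM_φ′·‖V(x,μ) − V(x−e_μ,μ)‖`
(`B9Eq373TransporterLipschitzLetters.norm_adTransportW_inv_sub_adTransportW_inv_le`). [folklore]
[cite: Balaban1985BackgroundPropagators, (3.73) p.405, (3.70) p.404] -/
theorem norm_covDiff_le_on_of_sub (x : TSite d Pd) (μ : Fin d) (hx : p (x, μ)) (hx' : p (unshift μ x, μ)) (w : W) :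
    ‖(adTransportW φ (gaugeU g 1) (x, μ) (adTransportW φ (fun b => (U b)⁻¹) (x, μ) w) - w) -
      adTransportW φ (fun b => (gaugeU g 1 b)⁻¹) (unshift μ x, μ)
        (adTransportW φ (gaugeU g 1) (unshift μ x, μ) (adTransportW φ (fun b => (U b)⁻¹) (unshift μ x, μ)
          (adTransportW φ (gaugeU g 1) (unshift μ x, μ) w)) - adTransportW φ (gaugeU g 1) (unshift μ x, μ) w)‖ ≤
      2 * Mφ * Mφ' * ‖(V (x, μ) : 𝔸) - (V (unshift μ x, μ) : 𝔸)‖ * ‖w‖ :=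
  norm_covDiff_le_on φ g hAd V U p hagree x μ hx hx'
    (fun w => norm_adTransportW_inv_sub_adTransportW_inv_le φ hφ hφ' hMφ' V V (x, μ) (unshift μ x, μ) (hV1 _) (hV1 _) w) w

include hφ hφ' hMφ hMφ' hAd hV1 hagree in
/-- **`hD` ON THE CUBE IN THE GAUGE (3.35)**: `V(b) = e^{iηA(b)}` as group elements at the two bonds, `η ≥ 0`, `‖A‖ ≤ r` there, and the GRADIENT LETTER
`‖A(x,μ) − A(x−e_μ,μ)‖ ≤ η·a′` ⟹ `ε′ = 2M_φM_φ′·(η·(η·a′)·e^{ηr})` — so `t²·ε′ = O(a′)` at `t = η⁻¹`: print's «the derivatives are … the covariant derivatives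
defined by U», `b′ = O(η²|∇^ηA|)`. [folklore] [cite: Balaban1985BackgroundPropagators, (3.73) p.405, (3.35) p.396] -/
theorem norm_covDiff_le_on_exp [CompleteSpace 𝔸] (x : TSite d Pd) (μ : Fin d) (hx : p (x, μ)) (hx' : p (unshift μ x, μ)) {η r a' : ℝ} (hη : 0 ≤ η)
    (A : Bond d Pd → 𝔸) (hVA : (V (x, μ) : 𝔸) = NormedSpace.exp ((Complex.I * η : ℂ) • A (x, μ)))
    (hVA' : (V (unshift μ x, μ) : 𝔸) = NormedSpace.exp ((Complex.I * η : ℂ) • A (unshift μ x, μ)))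
    (hA : ‖A (x, μ)‖ ≤ r) (hA' : ‖A (unshift μ x, μ)‖ ≤ r) (hdA : ‖A (x, μ) - A (unshift μ x, μ)‖ ≤ η * a') (w : W) :
    ‖(adTransportW φ (gaugeU g 1) (x, μ) (adTransportW φ (fun b => (U b)⁻¹) (x, μ) w) - w) -
      adTransportW φ (fun b => (gaugeU g 1 b)⁻¹) (unshift μ x, μ)
        (adTransportW φ (gaugeU g 1) (unshift μ x, μ) (adTransportW φ (fun b => (U b)⁻¹) (unshift μ x, μ)
          (adTransportW φ (gaugeU g 1) (unshift μ x, μ) w)) - adTransportW φ (gaugeU g 1) (unshift μ x, μ) w)‖ ≤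
      2 * Mφ * Mφ' * (η * (η * a') * Real.exp (η * r)) * ‖w‖ := by
  refine (norm_covDiff_le_on_of_sub φ hφ hφ' hMφ' g hAd V hV1 U p hagree x μ hx hx' w).trans ?_
  have hw : 0 ≤ ‖w‖ := norm_nonneg w
  have hM : 0 ≤ 2 * Mφ * Mφ' := by positivity
  have hexp : ‖(V (x, μ) : 𝔸) - (V (unshift μ x, μ) : 𝔸)‖ ≤ η * (η * a') * Real.exp (η * r) := by
    rw [hVA, hVA']
    exact (norm_exp_smul_sub_exp_smul_le hη hA hA').trans
      (mul_le_mul_of_nonneg_right (mul_le_mul_of_nonneg_left hdA hη) (Real.exp_pos _).le)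
  exact mul_le_mul_of_nonneg_right (mul_le_mul_of_nonneg_left hexp hM) hw

/-! ## §3 Packaging for `B9Eq342GradientRowAssembly` at one output bond -/

include hφ hφ' hMφ' hAd hV1 hagree hδ₀ in
/-- **THE CUBE LETTERS IN THE ASSEMBLY's SHAPES**: for a site set `Ω` whose `2d` incident bonds `(x,μ)`, `(x−e_μ,μ)` (`x ∈ Ω`) lie in `p`, and a
consecutive-transporter letter `ε′` on `Ω`: the conjunction of `hBp`, `hBm`, `hBt` (with `b = 2M_φM_φ′δ₀`) and `hD` (with `b′ = ε′`) of
`B9Eq342GradientRowAssembly.norm_covDeriv_le_weighted_of_letters(_uniform∕_penalty)` at the pair `R = R_U`, `S = S_U`, `R⁰ = R(1^g)`, `S⁰`. [folklore]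
[cite: Balaban1985BackgroundPropagators, (3.35) p.396, (3.43) p.398, (3.70)–(3.73) pp.404–405] -/
theorem cube_letters (Ω : Set (TSite d Pd)) (hΩ : ∀ x ∈ Ω, ∀ μ : Fin d, p (x, μ) ∧ p (unshift μ x, μ)) {ε' : ℝ}
    (hdV' : ∀ x ∈ Ω, ∀ (μ : Fin d) (w : W),
      ‖adTransportW φ (fun b => (V b)⁻¹) (x, μ) w - adTransportW φ (fun b => (V b)⁻¹) (unshift μ x, μ) w‖ ≤ ε' * ‖w‖) :
    (∀ x ∈ Ω, ∀ (μ : Fin d) (w : W),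
        ‖adTransportW φ (gaugeU g 1) (x, μ) (adTransportW φ (fun b => (U b)⁻¹) (x, μ) w) - w‖ ≤ 2 * Mφ * Mφ' * δ₀ * ‖w‖) ∧
      (∀ x ∈ Ω, ∀ (μ : Fin d) (w : W),
        ‖adTransportW φ (gaugeU g 1) (unshift μ x, μ) (adTransportW φ (fun b => (U b)⁻¹) (unshift μ x, μ) w) - w‖ ≤ 2 * Mφ * Mφ' * δ₀ * ‖w‖) ∧
      (∀ x ∈ Ω, ∀ (μ : Fin d) (w : W),
        ‖adTransportW φ (fun b => (gaugeU g 1 b)⁻¹) (unshift μ x, μ) w - adTransportW φ (fun b => (U b)⁻¹) (unshift μ x, μ) w‖ ≤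
          2 * Mφ * Mφ' * δ₀ * ‖w‖) ∧
      (∀ x ∈ Ω, ∀ (μ : Fin d) (w : W),
        ‖(adTransportW φ (gaugeU g 1) (x, μ) (adTransportW φ (fun b => (U b)⁻¹) (x, μ) w) - w) -
          adTransportW φ (fun b => (gaugeU g 1 b)⁻¹) (unshift μ x, μ)
            (adTransportW φ (gaugeU g 1) (unshift μ x, μ) (adTransportW φ (fun b => (U b)⁻¹) (unshift μ x, μ)
              (adTransportW φ (gaugeU g 1) (unshift μ x, μ) w)) - adTransportW φ (gaugeU g 1) (unshift μ x, μ) w)‖ ≤ ε' * ‖w‖) :=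
  ⟨fun x hx μ w => norm_rel_sub_le_on φ hφ hφ' hMφ' g hAd V hV1 U p hagree hδ₀ (x, μ) (hΩ x hx μ).1 w,
    fun x hx μ w => norm_rel_sub_le_on φ hφ hφ' hMφ' g hAd V hV1 U p hagree hδ₀ (unshift μ x, μ) (hΩ x hx μ).2 w,
    fun x hx μ w => norm_inv_sub_le_on φ hφ hφ' hMφ' g hAd V hV1 U p hagree hδ₀ (unshift μ x, μ) (hΩ x hx μ).2 w,
    fun x hx μ w => norm_covDiff_le_on φ g hAd V U p hagree x μ (hΩ x hx μ).1 (hΩ x hx μ).2 (hdV' x hx μ) w⟩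

/-! ## §4 The per-cube pair inhabits `hagree` and `hAd`: `U = Ũ^{g₀⁻¹}` on `p`, and `g₀⁻¹` is fibrewise isometric with `g₀` -/

omit [NormedAlgebra ℂ 𝔸] [NormOneClass 𝔸] in
/-- **`gaugeU g₀ U = Ũ` on `p` ⟹ `U = gaugeU g₀⁻¹ Ũ` on `p`** — the orientation of `B9Eq387CubeReductionGaugeBackground.exists_gauge_background_letters`
(`∀ b, p b → gaugeU g₀ U b = Ũ b`) turned into this file's `hagree` with `g := g₀⁻¹`, `V := Ũ` (bondwise: `gaugeU g V b` reads `V b` only). [folklore]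
[cite: Balaban1985BackgroundPropagators, (3.28) p.395, (3.35) p.396] -/
theorem agree_inv_of_gauge_eq {g₀ : TSite d Pd → 𝔸ˣ} {U Ut : Bond d Pd → 𝔸ˣ} {p : Bond d Pd → Prop} (h : ∀ b, p b → gaugeU g₀ U b = Ut b) :
    ∀ b, p b → U b = gaugeU g₀⁻¹ Ut b := fun b hb => by
  rw [gaugeU_apply, ← h b hb, gaugeU_apply, Pi.inv_apply, Pi.inv_apply, inv_inv]
  rw [← mul_assoc, ← mul_assoc, inv_mul_cancel, one_mul, mul_assoc, inv_mul_cancel, mul_one]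

omit [NormOneClass 𝔸] in
/-- **`hAd` for `g₀⁻¹` from `hAd` for `g₀`**: `⟪R(g₀(x)⁻¹)v, R(g₀(x)⁻¹)v′⟫ = ⟪v, v′⟫` (apply the isometry of `R(g₀(x))` to `R(g₀(x)⁻¹)v`, `R(g₀(x)⁻¹)v′` and cancel).
[folklore] [cite: Balaban1985BackgroundPropagators, (3.30) p.395] -/
theorem hAd_inv {g₀ : TSite d Pd → 𝔸ˣ} (hAd₀ : ∀ (x : TSite d Pd) (v v' : W), ⟪AdW φ (g₀ x) v, AdW φ (g₀ x) v'⟫_ℂ = ⟪v, v'⟫_ℂ)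
    (x : TSite d Pd) (v v' : W) : ⟪AdW φ (g₀⁻¹ x) v, AdW φ (g₀⁻¹ x) v'⟫_ℂ = ⟪v, v'⟫_ℂ := by
  have h := hAd₀ x (AdW φ (g₀ x)⁻¹ v) (AdW φ (g₀ x)⁻¹ v')
  rw [B9Eq328GaugeAction.AdW_apply_inv, B9Eq328GaugeAction.AdW_apply_inv] at h
  rw [Pi.inv_apply]
  exact h.symm

end Literature.MathematicalPhysics.QuantumFieldTheory.Balaban1983to89.B9Eq342GradientRowCubeLetters

end
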